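import Literature.Geometry.Lorentzian.EndVolume
import Literature.Geometry.Lorentzian.ChartLaplacian
import Literature.Geometry.Lorentzian.ConnectionNaturality
import Literature.Geometry.Lorentzian.MassCapacity
import HarnessLib

/-!
# Integrals over an asymptotically flat end and `h⁻¹(du, dv)` in the chart of the end

Support file (all results proved, no named facts) for the analysis of Schoen–Yau's conformal
equation on an asymptotically flat `3`-manifold (Comm. Math. Phys. 65 (1979), §3): flux
integrals such as `∫_N ⟨dχ, dv⟩_h dV_h` over the end `N_k` (the mass term (3.16),
`A = −(1/4π) ∫_N (fv + h)`) are computed in the chart of the end `Φ = e.dataChart`, where the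
metric has the components `h_{ij} = hCoeff e D`, functions are read as `endValue e v = v ∘ Φ`,
and the Riemannian measure is `√(det h_{ij}) dz` (`EndVolume.lean`). This file provides the two
missing bridges:

* `PseudoRiemannianMetric.sharp_comap_mfderiv_apply`, `innerDual_comap_apply`,
  `innerDual_mvfderiv_comp` — **naturality of the inverse metric on covectors** under an
  equidimensional immersion `Φ : N → M`: `(Φ^*g)⁻¹_u(α ∘ dΦ, β ∘ dΦ) = g⁻¹_{Φ u}(α, β)`, in
  particular `(Φ^*g)⁻¹(d(w ∘ Φ), d(v ∘ Φ)) = g⁻¹(dw, dv) ∘ Φ` (O'Neill 1983, Ch. 3, p. 60 and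
  Prop. 3.59: local isometries preserve all metric tensors);
* `OpensChart.localFrame_eq`, `OpensChart.innerDual_eq_sum` — on an open subset `U ⊆ E` with
  metric components `G`, `g⁻¹_x(α, β) = ∑ₖₗ Ĝᵏˡ β(bₖ) α(bₗ)` in any basis `b` of `E`
  (`innerDual_eq_sum_localFrame` of `ChartLaplacian.lean`, the coordinate frame of the identity
  chart being the constant frame `b`);
* `AFEnd.innerDual_mvfderiv_dataChart` — **`h⁻¹(dw, dv)` at a point `Φ z` of the end**:
  `∑ₖₗ (h_{ij}(z))⁻¹ₖₗ ∂ₖ(v ∘ Φ)(z) ∂ₗ(w ∘ Φ)(z)` with `h_{ij} = hCoeff e D`, `v ∘ Φ = endValue e v`;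
* `AFEnd.setIntegral_far`, `AFEnd.integral_eq_setIntegral_far` — **Bochner integration over a
  far region in the chart**: `∫_{far R'} g dV_h = ∫_{R' < ‖z‖} g(Φ z) √(det h_{ij}(z)) dz`
  (the real-valued companion of `AFEnd.setLIntegral_far`), and the same for `∫_X g` when `g` is
  supported in the far region.

## References

* R. Schoen, S.-T. Yau, *On the proof of the positive mass conjecture in general relativity*,
  Comm. Math. Phys. 65 (1979) 45–76, §3, (3.16) and the proof of Lemma 3.2.
* B. O'Neill, *Semi-Riemannian geometry*, Academic Press 1983, Ch. 3, p. 60 and Prop. 3.59.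
* H. Federer, *Geometric Measure Theory* (1969), §3.2.46; J. M. Lee, *Introduction to
  Riemannian Manifolds* (2018), Prop. 2.41 (`dV_g = √(det g_{ij}) dx`).
-/

noncomputable section

open Bundle Set Function Filter Manifold MeasureTheory Measure TopologicalSpace
open scoped Manifold ContDiff Topology Matrix ENNReal

namespace Literature.Geometry.Lorentzian

/-! ### Naturality of the inverse metric on covectors -/

namespace PseudoRiemannianMetric

section Comap

variable {E : Type*} [NormedAddCommGroup E] [NormedSpace ℝ E] {H : Type*} [TopologicalSpace H]
  {I : ModelWithCorners ℝ E H} {M : Type*} [TopologicalSpace M] [ChartedSpace H M]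
  [IsManifold I ∞ M]
  {E' : Type*} [NormedAddCommGroup E'] [NormedSpace ℝ E'] {H' : Type*} [TopologicalSpace H']
  {I' : ModelWithCorners ℝ E' H'} {N : Type*} [TopologicalSpace N] [ChartedSpace H' N]
  [IsManifold I' ∞ N]
  [FiniteDimensional ℝ E] [FiniteDimensional ℝ E'] {n : ℕ∞ω}
  (g : PseudoRiemannianMetric I n E (TangentSpace I : M → Type _))
  {Φ : N → M} (hpb : contMDiff_pullbackBilin I M I' N n) (hΦ : ContMDiff I' I (n + 1) Φ)
  (hΦ' : ∀ u, Function.Injective (mfderiv I' I Φ u))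
  (hdim : Module.finrank ℝ E' = Module.finrank ℝ E)

/-- **`♯` is natural**: for the pullback metric `Φ^*g` along an equidimensional immersion,
`♯_{Φ^*g}(β ∘ dΦ_u) = dΦ_u⁻¹ (♯_g β)` (both sides have the same `Φ^*g`-products with every
vector, `(Φ^*g)(dΦ⁻¹ ♯β, w) = g(♯β, dΦ w) = β(dΦ w)`); the form with `dΦ_u` as the linear
equivalence `mfderivEquivOfInjective` is `sharp_comap_apply` of `InitialDataPullback.lean`.
O'Neill 1983, Ch. 3, p. 60 with Prop. 3.59. [cite: ONeill1983, Ch. 3, p. 60] -/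
theorem sharp_comap_mfderiv_apply (u : N) (β : Module.Dual ℝ (TangentSpace I (Φ u))) :
    (g.comap hpb Φ hΦ hΦ' hdim).sharp u (β ∘ₗ (mfderiv I' I Φ u).toLinearMap) =
      (mfderivEquivOfInjective (I := I) (I' := I') Φ u (hΦ' u) hdim).symm (g.sharp (Φ u) β) := by
  refine sharp_eq_of_forall _ u _ _ fun w ↦ ?_
  rw [val_comap, pullbackBilin_apply, mfderiv_mfderivEquivOfInjective_symm, val_sharp_apply]
  rfl

/-- **The inverse metric on covectors is natural**: `(Φ^*g)⁻¹_u(α ∘ dΦ_u, β ∘ dΦ_u) =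
g⁻¹_{Φ u}(α, β)` for an equidimensional immersion `Φ` (O'Neill 1983, Ch. 3, p. 60 and
Prop. 3.59). [cite: ONeill1983, Ch. 3, Prop. 3.59] -/
theorem innerDual_comap_apply (u : N) (α β : Module.Dual ℝ (TangentSpace I (Φ u))) :
    (g.comap hpb Φ hΦ hΦ' hdim).innerDual u (α ∘ₗ (mfderiv I' I Φ u).toLinearMap)
      (β ∘ₗ (mfderiv I' I Φ u).toLinearMap) = g.innerDual (Φ u) α β := by
  rw [innerDual, sharp_comap_mfderiv_apply, LinearMap.comp_apply, ContinuousLinearMap.coe_coe,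
    mfderiv_mfderivEquivOfInjective_symm, innerDual]

/-- **`(Φ^*g)⁻¹(d(w∘Φ), d(v∘Φ))(u) = g⁻¹(dw, dv)(Φ u)`** for functions `w, v` differentiable at
`Φ u` (chain rule `d(w ∘ Φ)_u = dw_{Φ u} ∘ dΦ_u` and `innerDual_comap_apply`). This is how
`|∇v|²_h` and `⟨∇χ, ∇v⟩_h` are read in the chart of an asymptotically flat end.
[cite: ONeill1983, Ch. 3, Prop. 3.59] -/
theorem innerDual_mvfderiv_comp (u : N) {w v : M → ℝ} (hw : MDifferentiableAt I 𝓘(ℝ, ℝ) w (Φ u))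
    (hv : MDifferentiableAt I 𝓘(ℝ, ℝ) v (Φ u)) :
    (g.comap hpb Φ hΦ hΦ' hdim).innerDual u (mvfderiv I' (w ∘ Φ) u).toLinearMap
      (mvfderiv I' (v ∘ Φ) u).toLinearMap =
      g.innerDual (Φ u) (mvfderiv I w (Φ u)).toLinearMap (mvfderiv I v (Φ u)).toLinearMap := by
  have h1 : (1 : ℕ∞ω) ≤ n + 1 := le_add_self
  have hΦu : MDifferentiableAt I' I Φ u := ((hΦ.of_le h1) u).mdifferentiableAt one_ne_zero
  have hcw : (mvfderiv I' (w ∘ Φ) u).toLinearMap =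
      (mvfderiv I w (Φ u)).toLinearMap ∘ₗ (mfderiv I' I Φ u).toLinearMap := by
    ext x
    exact mvfderiv_comp_apply hw hΦu x
  have hcv : (mvfderiv I' (v ∘ Φ) u).toLinearMap =
      (mvfderiv I v (Φ u)).toLinearMap ∘ₗ (mfderiv I' I Φ u).toLinearMap := by
    ext x
    exact mvfderiv_comp_apply hv hΦu x
  rw [hcw, hcv, innerDual_comap_apply]

end Comap

end PseudoRiemannianMetric

/-! ### The inverse metric on covectors on an open subset of a normed space -/

namespace OpensChart

variable {E : Type*} [NormedAddCommGroup E] [NormedSpace ℝ E] {U : Opens E}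

/-- On an open subset `U ⊆ E` (identity chart) the coordinate frame induced by the
trivialization at `x` and a basis `b` of `E` is the constant frame `b`. [folklore] -/
theorem localFrame_eq {ι : Type*} (b : Module.Basis ι ℝ E) (x y : U) (i : ι) :
    (trivializationAt E (TangentSpace 𝓘(ℝ, E)) x).localFrame b i y = b i := by
  have hy : y ∈ (trivializationAt E (TangentSpace 𝓘(ℝ, E)) x).baseSet := by
    simp [chartAt_source]
  rw [Trivialization.localFrame_apply_of_mem_baseSet _ b hy]
  have h3 : (trivializationAt E (TangentSpace 𝓘(ℝ, E)) x).basisAt b hy i =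
      (trivializationAt E (TangentSpace 𝓘(ℝ, E)) x).symm y (b i) := by
    simp [Trivialization.basisAt]
  rw [h3, trivializationAt_symm_apply]

variable [FiniteDimensional ℝ E] {n : ℕ∞ω}
  {g : PseudoRiemannianMetric 𝓘(ℝ, E) n E (TangentSpace 𝓘(ℝ, E) : U → Type _)}
  {G : E → E →L[ℝ] E →L[ℝ] ℝ} (hG : ∀ y : U, g.val y = G y)
include hG

/-- **The inverse metric on covectors in the identity chart**: for a metric on `U ⊆ E` with
components `G` and a basis `b` of `E`, `g⁻¹_x(α, β) = ∑ₗ ∑ₖ (Ĝ(x))⁻¹ₖₗ β(bₖ) α(bₗ)` with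
`Ĝ(x)ᵢⱼ = G x bᵢ bⱼ` (`innerDual_eq_sum_localFrame` in the constant frame). O'Neill 1983, Ch. 3,
p. 60 (`g^{ij}` is the inverse matrix). [cite: ONeill1983, Ch. 3, p. 60] -/
theorem innerDual_eq_sum {ι : Type*} [Fintype ι] [DecidableEq ι] (b : Module.Basis ι ℝ E) (x : U)
    (α β : Module.Dual ℝ (TangentSpace 𝓘(ℝ, E) x)) :
    g.innerDual x α β =
      ∑ l, ∑ k, (Matrix.of fun i j ↦ G x (b i) (b j))⁻¹ k l * β (b k) * α (b l) := by
  have hx : x ∈ (chartAt E x).source := by simp [chartAt_source]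
  rw [innerDual_eq_sum_localFrame g b hx α β]
  simp only [localFrame_eq, hG x]
  rfl

end OpensChart

/-! ### The end of an asymptotically flat manifold in its chart -/

namespace AFEnd

variable {X : Type} [TopologicalSpace X] [ChartedSpace E3 X] [IsManifold (𝓡 3) ∞ X]
  (e : AFEnd X) (D : InitialDataSet (𝓡 3) X)

omit [IsManifold (𝓡 3) ∞ X] in
/-- A function `w : X → ℝ` differentiable at a point `Φ z` of the end, read in the chart
(`endValue e w = w ∘ Φ` off the ball), is differentiable at `z`. [folklore] -/
theorem differentiableAt_endValue {w : X → ℝ} (z : exteriorRegion e.R)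
    (hw : MDifferentiableAt (𝓡 3) 𝓘(ℝ, ℝ) w (e.dataChart z)) :
    DifferentiableAt ℝ (endValue e w) z := by
  have hΦ : MDifferentiableAt 𝓘(ℝ, E3) (𝓡 3) e.dataChart z :=
    (e.contMDiff_dataChart z).mdifferentiableAt (by simp)
  have hcomp : MDifferentiableAt 𝓘(ℝ, E3) 𝓘(ℝ, ℝ) (w ∘ e.dataChart) z := hw.comp z hΦ
  exact (OpensChart.mdifferentiableAt_iff z (w ∘ e.dataChart) (endValue e w)
    (fun y ↦ (endValue_of_lt e w y.2).symm)).1 hcomp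

/-- **`h⁻¹(dw, dv)` in the chart of the end.** For `z` in the exterior region `{R < ‖z‖}` and
functions `w, v : X → ℝ` differentiable at `Φ z` (`Φ = e.dataChart`),
`h⁻¹_{Φ z}(dw, dv) = ∑ₗ ∑ₖ (h_{ij}(z))⁻¹ₖₗ ∂ₖ(v ∘ Φ)(z) ∂ₗ(w ∘ Φ)(z)` with
`h_{ij}(z) = hCoeff e D z (eᵢ, eⱼ)` the chart components of the metric and `v ∘ Φ = endValue e v`
(naturality `innerDual_mvfderiv_comp` along `Φ` — whose pullback metric has representative
`hCoeff`, `val_comap_dataChart` — and the identity-chart formula `OpensChart.innerDual_eq_sum`).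
O'Neill 1983, Ch. 3, p. 60 and Prop. 3.59; the quantity `⟨∇χ, ∇v⟩_h` on `N_k` in Schoen–Yau
1979, §3. [cite: ONeill1983, Ch. 3, p. 60 and Prop. 3.59] -/
theorem innerDual_mvfderiv_dataChart [D.metric.HasLeviCivita] (z : exteriorRegion e.R)
    {w v : X → ℝ} (hw : MDifferentiableAt (𝓡 3) 𝓘(ℝ, ℝ) w (e.dataChart z))
    (hv : MDifferentiableAt (𝓡 3) 𝓘(ℝ, ℝ) v (e.dataChart z)) :
    D.metric.innerDual (e.dataChart z) (mvfderiv (𝓡 3) w (e.dataChart z)).toLinearMap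
      (mvfderiv (𝓡 3) v (e.dataChart z)).toLinearMap =
      ∑ l, ∑ k, (Matrix.of fun i j ↦ hCoeff e D z (EuclideanSpace.single i 1)
          (EuclideanSpace.single j 1))⁻¹ k l *
        fderiv ℝ (endValue e v) z (EuclideanSpace.single k 1) *
        fderiv ℝ (endValue e w) z (EuclideanSpace.single l 1) := by
  classical
  set g' := D.metric.comap PseudoRiemannianMetric.contMDiff_pullbackBilin_holds e.dataChart
    e.contMDiff_dataChart_succ e.injective_mfderiv_dataChart rfl with hg'
  set b : Module.Basis (Fin 3) ℝ E3 := (EuclideanSpace.basisFun (Fin 3) ℝ).toBasis with hb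
  have hbi : ∀ i, b i = EuclideanSpace.single i 1 := fun i ↦ by
    rw [hb, OrthonormalBasis.coe_toBasis, EuclideanSpace.basisFun_apply]
  rw [← PseudoRiemannianMetric.innerDual_mvfderiv_comp D.metric
    PseudoRiemannianMetric.contMDiff_pullbackBilin_holds
    e.contMDiff_dataChart_succ e.injective_mfderiv_dataChart rfl z hw hv,
    OpensChart.innerDual_eq_sum (fun y ↦ e.val_comap_dataChart D y) b z]
  refine Finset.sum_congr rfl fun l _ ↦ Finset.sum_congr rfl fun k _ ↦ ?_
  have hrep : ∀ (u : X → ℝ), MDifferentiableAt (𝓡 3) 𝓘(ℝ, ℝ) u (e.dataChart z) →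
      ∀ i, (mvfderiv 𝓘(ℝ, E3) (u ∘ e.dataChart) z).toLinearMap (b i) =
        fderiv ℝ (endValue e u) z (EuclideanSpace.single i 1) := by
    intro u hu i
    rw [ContinuousLinearMap.coe_coe, hbi]
    exact OpensChart.mvfderiv_eq z (u ∘ e.dataChart) (endValue e u)
      (fun y ↦ (endValue_of_lt e u y.2).symm) (e.differentiableAt_endValue z hu) _
  rw [hrep v hv k, hrep w hw l]
  simp only [hbi]

/-! ### Bochner integrals over the end in the chart -/

variable [T2Space X] [LocallyCompactSpace X] [MeasurableSpace X] [BorelSpace X]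

/-- **Integration of a real function over a far region in the chart of the end**: for
`R ≤ R'` and every `g : X → ℝ`,
`∫_{R' < r} g dV_h = ∫_{R' < ‖z‖} g(Φ z) √(det h_{ij}(z)) dz` (both sides `0` when not
integrable) — the real-valued companion of `setLIntegral_far`, from the identity of measures
`val_* Φ^* vol_h = √(det h_{ij}) · Leb|_{R < ‖z‖}` (`map_comap_dataChart_riemannianMeasure`).
Federer 1969, §3.2.46; Lee 2018, Prop. 2.41. [cite: Federer1969, §3.2.46] -/
theorem setIntegral_far (g : X → ℝ) {R' : ℝ} (hR' : e.R ≤ R') :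
    ∫ p in e.far R', g p ∂riemannianMeasure D.h =
      ∫ z in {z : E3 | R' < ‖z‖}, g (e.dataChartExt z) * Real.sqrt (Matrix.of fun i j ↦
        hCoeff e D z (EuclideanSpace.single i 1) (EuclideanSpace.single j 1)).det := by
  set μ := riemannianMeasure D.h with hμ
  set dens : E3 → ℝ≥0∞ := fun z ↦ ENNReal.ofReal (Real.sqrt
    (Matrix.of fun i j ↦ hCoeff e D z (EuclideanSpace.single i 1) (EuclideanSpace.single j 1)).det)
    with hdens
  set A : Set E3 := {z | R' < ‖z‖} with hA
  have hAm : MeasurableSet A := (isOpen_lt continuous_const continuous_norm).measurableSet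
  have hA' : A ⊆ {z | e.R < ‖z‖} := fun z hz ↦ hR'.trans_lt hz
  have hExtm : MeasurableSet {z : E3 | e.R < ‖z‖} :=
    (isOpen_lt continuous_const continuous_norm).measurableSet
  have hemb := e.measurableEmbedding_dataChart (X := X)
  have hval : MeasurableEmbedding (Subtype.val : exteriorRegion e.R → E3) :=
    MeasurableEmbedding.subtype_coe hExtm
  -- the left-hand side as an integral against the pulled-back measure
  have h1 : ∫ p in e.far R', g p ∂μ = ∫ z in A, g (e.dataChartExt z)
      ∂(Measure.map (Subtype.val : exteriorRegion e.R → E3) (Measure.comap e.dataChart μ)) := by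
    rw [e.far_eq_image_dataChartExt hR', Measure.restrict_map measurable_subtype_coe hAm,
      hval.integral_map, hemb.restrict_comap, e.image_dataChartExt_eq hA']
    have hfun : (fun y : exteriorRegion e.R ↦ g (e.dataChartExt (y : E3))) =
        fun y ↦ g (e.dataChart y) := funext fun y ↦ by rw [e.dataChartExt_of_lt y.2]
    rw [hfun, ← hemb.integral_map, hemb.map_comap,
      Measure.restrict_restrict hemb.measurableSet_range,
      inter_eq_right.2 (image_subset_range _ _)]
  -- the right-hand side as an integral against Lebesgue measure with density
  have h2 : ∫ z in A, g (e.dataChartExt z) ∂((volume.restrict {z : E3 | e.R < ‖z‖}).withDensity dens) =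
      ∫ z in A, g (e.dataChartExt z) * Real.sqrt (Matrix.of fun i j ↦
        hCoeff e D z (EuclideanSpace.single i 1) (EuclideanSpace.single j 1)).det := by
    rw [restrict_withDensity hAm, Measure.restrict_restrict hAm, inter_eq_left.2 hA']
    have hae : AEMeasurable dens (volume.restrict A) :=
      ((e.continuousOn_sqrt_det_hCoeff D).mono hA').aemeasurable hAm
    rw [integral_withDensity_eq_integral_toReal_smul₀ hae
      (Eventually.of_forall fun _ ↦ ENNReal.ofReal_lt_top)]
    refine integral_congr_ae (Eventually.of_forall fun z ↦ ?_)
    simp only [hdens, ENNReal.toReal_ofReal (Real.sqrt_nonneg _), smul_eq_mul, mul_comm]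
  rw [h1, e.map_comap_dataChart_riemannianMeasure D, h2]

/-- **A function supported in a far region is integrated in the chart of the end**:
if `g : X → ℝ` vanishes off `far R'` (`R ≤ R'`), then
`∫_X g dV_h = ∫_{R' < ‖z‖} g(Φ z) √(det h_{ij}(z)) dz`. [cite: Federer1969, §3.2.46] -/
theorem integral_eq_setIntegral_far {g : X → ℝ} {R' : ℝ} (hR' : e.R ≤ R')
    (hsupp : support g ⊆ e.far R') :
    ∫ p, g p ∂riemannianMeasure D.h =
      ∫ z in {z : E3 | R' < ‖z‖}, g (e.dataChartExt z) * Real.sqrt (Matrix.of fun i j ↦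
        hCoeff e D z (EuclideanSpace.single i 1) (EuclideanSpace.single j 1)).det := by
  rw [← setIntegral_eq_integral_of_forall_compl_eq_zero (s := e.far R')
    (fun p hp ↦ notMem_support.1 (fun hp' ↦ hp (hsupp hp')))]
  exact e.setIntegral_far D g hR'

end AFEnd

end Literature.Geometry.Lorentzian

end
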